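import Mathlib.Analysis.PSeries
import Literature.Analysis.FunctionSpaces.TorusFourierModes
import Literature.Analysis.FunctionSpaces.TorusSpaceTime
import HarnessLib

/-!
# Absolutely convergent Fourier series of smooth fields on `T^d`; uniform convergence of truncations

Trunk: Sobolev (`Literature/Analysis/FunctionSpaces`). Theorem-only complements to
`TorusTrigPoly` / `TorusFourierCalculus` used in the passage to the limit of the Fourier–Galerkin
scheme for Navier–Stokes on the torus (Robinson–Rodrigo–Sadowski 2016, Thm. 4.4, Step 4, p. 77:
the weak formulation is first obtained for band-limited test fields `P_M ψ` and then for all test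
fields by letting `M → ∞`, which needs `P_M ψ → ψ` **uniformly together with first derivatives**;
Grafakos 2014, §3.2–3.3: smooth functions on the torus have absolutely summable Fourier
coefficients and their square partial sums converge uniformly; only the elementary decay
`(1 + |k|²)^m |ĝ(k)| ≤ ‖(1 - Δ/4π²)^m g‖_∞` is needed here).

## Contents (all proved)

* Lattice sums: `∑_{j ∈ ℤ} (1 + j²)⁻¹ < ∞` (`summable_inv_one_add_sq_int`), the product trick
  `∑_{k ∈ ℤ^d} ∏ᵢ a(kᵢ) ≤ (∑_j a j)^{#d}` (`summable_pi_prod_of_summable`), hence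
  `∑_{k ∈ ℤ^d} ((1 + |k|²)^{#d})⁻¹ < ∞` (`summable_inv_one_add_freqNormSq_pow_card`).
* Fourier coefficients of the iterated elliptic operator `((1 - (4π²)⁻¹Δ)^m a)^(k) = (1 + |k|²)^m â(k)`
  (`mFourierCoeff_complexify_iterate_oneSubLaplacian`).
* Decay and absolute summability for smooth real vector fields:
  `(1 + |k|²)^m ‖â(k)‖ ≤ sup ‖(1 - Δ/4π²)^m a‖`, `∑_k ‖â(k)‖ < ∞` with the explicit bound
  `∑_k ‖â(k)‖ ≤ (∑_k ((1+|k|²)^{#d})⁻¹) · sup ‖(1 - Δ/4π²)^{#d} a‖`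
  (`summable_norm_mFourierCoeff_of_isSmooth`, `tsum_compl_norm_mFourierCoeff_le`).
* Uniform convergence of the Fourier truncations `Torus.fourierTruncate N a → a` for smooth `a`
  (pointwise inversion from Mathlib's `UnitAddTorus.hasSum_mFourier_series_apply_of_summable`,
  componentwise), with the sup bounds `‖a x - P_N a x‖ ≤ ∑_{k ∉ ball N} ‖â k‖ → 0` and
  `‖P_N a x‖ ≤ ‖a x‖ + ∑_{k ∉ ball N} ‖â k‖`, and `∂ᵢ P_N a = P_N ∂ᵢ a`, `Δ P_N a = P_N Δa`.
* Smooth space–time fields on `ℝ × T^d`: `d/dt 𝓕(ψ t)(k) = 𝓕(∂ₜψ t)(k)`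
  (`hasDerivAt_mFourierCoeff_slice`) and the uniform truncation error on `[0, T] × T^d`
  (`exists_norm_sub_fourierTruncate_le_spaceTime`).

## Mathlib search

Mathlib (this pin) has uniform/pointwise convergence of multiple Fourier series of continuous
functions with summable coefficients (`UnitAddTorus.hasSum_mFourier_series_of_summable`) and
`p`-series over `ℤ` (`summable_one_div_int_pow`), and lattice `p`-series for abstract `ℤ`-lattices
(`ZLattice.summable_norm_rpow`); the elementary product bound over `ℤ^d = d → ℤ` used here avoids
the lattice API. No decay-of-coefficients lemma for smooth functions on `UnitAddTorus`
(searched `mFourierCoeff.*iteratedFDeriv`, `summable_mFourierCoeff`: none).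

## References

* L. Grafakos, *Classical Fourier Analysis*, 3rd ed., GTM 249 (Springer 2014), Prop. 3.2.6 (8),
  Prop. 3.2.7, §3.3.1 (decay of Fourier coefficients of smooth functions; absolute convergence).
* J. C. Robinson, J. L. Rodrigo, W. Sadowski, *The Three-Dimensional Navier–Stokes Equations*,
  CUP 2016, Thm. 1.4 / §1.5 (Fourier expansions on `𝕋³`), Thm. 4.4 Step 4 (p. 77).
-/

noncomputable section

open MeasureTheory Set Filter Topology UnitAddTorus Finset
open scoped ENNReal NNReal InnerProductSpace ContDiff

namespace Literature.Analysis.FunctionSpaces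

namespace Torus

variable {d : Type*} [Fintype d]

/-! ## Lattice sums -/

section Lattice

/-- `∑_{j ∈ ℤ} (1 + j²)⁻¹ < ∞` (comparison with the `p`-series `∑ 1/j²`, Mathlib
`summable_one_div_int_pow`, plus the single term `j = 0`). [folklore] -/
theorem summable_inv_one_add_sq_int : Summable (fun j : ℤ => (1 + (j : ℝ) ^ 2)⁻¹) := by
  have h2 : Summable (fun j : ℤ => 1 / (j : ℝ) ^ 2) :=
    Real.summable_one_div_int_pow.2 (by norm_num)
  have h0 : Summable (fun j : ℤ => if j = 0 then (1 : ℝ) else 0) :=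
    summable_of_ne_finset_zero (s := {0}) fun j hj => by
      rw [Finset.mem_singleton] at hj
      rw [if_neg hj]
  refine Summable.of_nonneg_of_le (fun j => by positivity) (fun j => ?_) (h2.add h0)
  by_cases hj : j = 0
  · subst hj; simp
  · rw [if_neg hj, add_zero]
    have hj' : (0 : ℝ) < (j : ℝ) ^ 2 := by positivity
    rw [inv_eq_one_div]
    exact one_div_le_one_div_of_le hj' (by linarith)

/-- Every finite set of lattice points lies in a cube `T^d`, `T ⊆ ℤ` finite. [folklore] -/
theorem exists_subset_piFinset [DecidableEq d] (u : Finset (d → ℤ)) :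
    ∃ T : Finset ℤ, u ⊆ Fintype.piFinset fun _ : d => T := by
  classical
  refine ⟨u.biUnion fun k => Finset.univ.image k, fun k hk => ?_⟩
  rw [Fintype.mem_piFinset]
  intro i
  exact Finset.mem_biUnion.2 ⟨k, hk, Finset.mem_image.2 ⟨i, Finset.mem_univ _, rfl⟩⟩

/-- **The product trick for lattice sums**: if `a : ℤ → ℝ` is nonnegative and summable then
`k ↦ ∏ᵢ a (k i)` is summable over `ℤ^d` (every finite partial sum lies in a cube
`T^d ⊆ ℤ^d`, on which the sum factorises, `Finset.sum_prod_piFinset`, and is bounded by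
`(∑_j a j)^{#d}`). [folklore] -/
theorem summable_pi_prod_of_summable {a : ℤ → ℝ} (ha : ∀ j, 0 ≤ a j) (hs : Summable a) :
    Summable (fun k : d → ℤ => ∏ i, a (k i)) := by
  classical
  have hnn : ∀ k : d → ℤ, 0 ≤ ∏ i, a (k i) := fun k => Finset.prod_nonneg fun i _ => ha _
  refine summable_of_sum_le hnn (c := (∑' j, a j) ^ Fintype.card d) fun u => ?_
  obtain ⟨T, hsub⟩ := exists_subset_piFinset u
  have h1 : ∑ k ∈ u, ∏ i, a (k i) ≤ ∑ k ∈ Fintype.piFinset (fun _ : d => T), ∏ i, a (k i) :=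
    Finset.sum_le_sum_of_subset_of_nonneg hsub fun k _ _ => hnn k
  have h2 : ∑ k ∈ Fintype.piFinset (fun _ : d => T), ∏ i, a (k i) = ∏ _i : d, ∑ j ∈ T, a j :=
    Finset.sum_prod_piFinset T fun (_ : d) j => a j
  have h3 : ∏ _i : d, ∑ j ∈ T, a j ≤ ∏ _i : d, ∑' j, a j :=
    Finset.prod_le_prod (fun i _ => Finset.sum_nonneg fun j _ => ha j)
      fun i _ => hs.sum_le_tsum T fun j _ => ha j
  simp only [Finset.prod_const, Finset.card_univ] at h2 h3
  linarith

/-- `∑_{k ∈ ℤ^d} ∏ᵢ (1 + kᵢ²)⁻¹ < ∞`. [folklore] -/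
theorem summable_prod_inv_one_add_sq :
    Summable (fun k : d → ℤ => ∏ i, (1 + ((k i : ℝ)) ^ 2)⁻¹) :=
  summable_pi_prod_of_summable (a := fun j : ℤ => (1 + (j : ℝ) ^ 2)⁻¹) (fun j => by positivity)
    summable_inv_one_add_sq_int

/-- `∏ᵢ (1 + kᵢ²) ≤ (1 + |k|²)^{#d}` (each factor is at most `1 + |k|²`). [folklore] -/
theorem prod_one_add_sq_le_pow (k : d → ℤ) :
    ∏ i, (1 + ((k i : ℝ)) ^ 2) ≤ (1 + freqNormSq k) ^ Fintype.card d := by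
  rw [← Finset.card_univ, ← Finset.prod_const]
  refine Finset.prod_le_prod (fun i _ => by positivity) fun i _ => ?_
  have : ((k i : ℝ)) ^ 2 ≤ freqNormSq k :=
    Finset.single_le_sum (f := fun j => ((k j : ℝ)) ^ 2) (fun j _ => sq_nonneg _)
      (Finset.mem_univ i)
  linarith

/-- **`∑_{k ∈ ℤ^d} ((1 + |k|²)^{#d})⁻¹ < ∞`** (comparison with the product sum). [folklore] -/
theorem summable_inv_one_add_freqNormSq_pow_card :
    Summable (fun k : d → ℤ => ((1 + freqNormSq k) ^ Fintype.card d)⁻¹) := by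
  refine Summable.of_nonneg_of_le (fun k => ?_) (fun k => ?_) summable_prod_inv_one_add_sq
  · exact inv_nonneg.2 (pow_nonneg (by linarith [freqNormSq_nonneg k]) _)
  · rw [Finset.prod_inv_distrib]
    have hpos : 0 < ∏ i, (1 + ((k i : ℝ)) ^ 2) := Finset.prod_pos fun i _ => by positivity
    exact inv_anti₀ hpos (prod_one_add_sq_le_pow k)

end Lattice

/-! ## Decay of the Fourier coefficients of smooth real vector fields -/

section Decay

variable [DecidableEq d]

omit [DecidableEq d] in
/-- Fourier coefficients are bounded by the sup norm: `‖ĝ(k)‖ ≤ C` if `‖g x‖ ≤ C` for all `x`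
(`T^d` has measure `1`). [folklore] -/
theorem norm_mFourierCoeff_le_of_forall_norm_le {E : Type*} [NormedAddCommGroup E] [NormedSpace ℂ E]
    [CompleteSpace E] {g : UnitAddTorus d → E} {C : ℝ} (hC : ∀ x, ‖g x‖ ≤ C) (k : d → ℤ) :
    ‖mFourierCoeff g k‖ ≤ C := by
  rw [mFourierCoeff_eq_integral_volume]
  have h := norm_integral_le_of_norm_le_const (μ := (volume : Measure (UnitAddTorus d)))
    (f := fun x => mFourier (-k) x • g x) (C := C) (Eventually.of_forall fun x => by
      rw [norm_smul]
      calc ‖mFourier (-k) x‖ * ‖g x‖ ≤ 1 * ‖g x‖ :=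
            mul_le_mul_of_nonneg_right (((mFourier (-k)).norm_coe_le_norm x).trans_eq mFourier_norm)
              (norm_nonneg _)
        _ ≤ C := by rw [one_mul]; exact hC x)
  simpa using h

omit [DecidableEq d] in
/-- Fourier coefficients of `b - c • Δb'`-type combinations of integrable real fields:
`𝓕(complexify ∘ (b - c • b'))(k) = 𝓕(complexify ∘ b)(k) - c • 𝓕(complexify ∘ b')(k)` (`c ∈ ℝ`). [folklore] -/
theorem mFourierCoeff_complexify_sub_const_smul {b b' : UnitAddTorus d → EuclideanSpace ℝ d}
    (hb : Integrable b volume) (hb' : Integrable b' volume) (c : ℝ) (k : d → ℤ) :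
    mFourierCoeff (EuclideanSpace.complexify ∘ fun x => b x - c • b' x) k =
      mFourierCoeff (EuclideanSpace.complexify ∘ b) k -
        (c : ℂ) • mFourierCoeff (EuclideanSpace.complexify ∘ b') k := by
  have hφ : MemLp (fun x : UnitAddTorus d => mFourier (-k) x) ∞ volume :=
    memLp_top_of_bound (mFourier (-k)).continuous.aestronglyMeasurable 1
      (Eventually.of_forall fun x => ((mFourier (-k)).norm_coe_le_norm x).trans_eq mFourier_norm)
  have hi : Integrable (fun x => mFourier (-k) x • (EuclideanSpace.complexify ∘ b) x) volume :=
    (integrable_complexify_comp hb).smul_of_top_right hφ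
  have hi' : Integrable (fun x => mFourier (-k) x • (EuclideanSpace.complexify ∘ b') x) volume :=
    (integrable_complexify_comp hb').smul_of_top_right hφ
  have hi'' : Integrable (fun x => (c : ℂ) • (mFourier (-k) x • (EuclideanSpace.complexify ∘ b') x))
      volume := hi'.smul (c : ℂ)
  rw [mFourierCoeff_eq_integral_volume, mFourierCoeff_eq_integral_volume,
    mFourierCoeff_eq_integral_volume, ← integral_smul, ← integral_sub hi hi'']
  refine integral_congr_ae (ae_of_all _ fun x => ?_)
  simp only [Function.comp_apply, map_sub, smul_sub]
  congr 1
  have hcx : EuclideanSpace.complexify (c • b' x) = (c : ℂ) • EuclideanSpace.complexify (b' x) := by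
    ext i
    simp [EuclideanSpace.complexify_apply]
  rw [hcx, smul_comm]

omit [DecidableEq d] in
/-- The elliptic operator `b ↦ b - (4π²)⁻¹ Δb` preserves smoothness, and so do its iterates. [folklore] -/
theorem isSmooth_iterate_oneSubLaplacian {a : UnitAddTorus d → EuclideanSpace ℝ d} (ha : IsSmooth a)
    (m : ℕ) :
    IsSmooth ((fun b : UnitAddTorus d → EuclideanSpace ℝ d =>
      fun x => b x - (4 * Real.pi ^ 2)⁻¹ • laplacian b x)^[m] a) := by
  induction m generalizing a with
  | zero => exact ha
  | succ m ih =>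
    rw [Function.iterate_succ_apply]
    exact ih (ha.sub (ha.laplacian.smul _))

/-- **Fourier multiplier of the iterated elliptic operator**:
`𝓕(complexify ∘ (1 - (4π²)⁻¹Δ)^m a)(k) = (1 + |k|²)^m 𝓕(complexify ∘ a)(k)` for smooth `a`
(Grafakos 2014, Prop. 3.2.6 (8) iterated). [cite: Grafakos2014, Prop. 3.2.6 (8)] -/
theorem mFourierCoeff_complexify_iterate_oneSubLaplacian {a : UnitAddTorus d → EuclideanSpace ℝ d}
    (ha : IsSmooth a) (m : ℕ) (k : d → ℤ) :
    mFourierCoeff (EuclideanSpace.complexify ∘ (fun b : UnitAddTorus d → EuclideanSpace ℝ d =>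
      fun x => b x - (4 * Real.pi ^ 2)⁻¹ • laplacian b x)^[m] a) k =
      (((1 + freqNormSq k) ^ m : ℝ) : ℂ) • mFourierCoeff (EuclideanSpace.complexify ∘ a) k := by
  induction m generalizing a with
  | zero => simp
  | succ m ih =>
    have hstep : IsSmooth (fun x => a x - (4 * Real.pi ^ 2)⁻¹ • laplacian a x) :=
      ha.sub (ha.laplacian.smul _)
    rw [Function.iterate_succ_apply, ih hstep,
      mFourierCoeff_complexify_sub_const_smul ha.integrable ha.laplacian.integrable,
      mFourierCoeff_complexify_laplacian ha, smul_neg, sub_neg_eq_add, smul_smul]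
    rw [show mFourierCoeff (EuclideanSpace.complexify ∘ a) k +
        ((((4 * Real.pi ^ 2)⁻¹ : ℝ) : ℂ) * ((4 * Real.pi ^ 2 * freqNormSq k : ℝ) : ℂ)) •
          mFourierCoeff (EuclideanSpace.complexify ∘ a) k =
        ((1 + freqNormSq k : ℝ) : ℂ) • mFourierCoeff (EuclideanSpace.complexify ∘ a) k by
      push_cast
      rw [add_smul, one_smul]
      congr 1
      have hπ : (Real.pi : ℂ) ≠ 0 := by exact_mod_cast Real.pi_ne_zero
      field_simp]
    rw [smul_smul]
    congr 1
    push_cast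
    ring

/-- **Decay of the Fourier coefficients of a smooth real vector field**: if
`‖((1 - (4π²)⁻¹Δ)^m a)(x)‖ ≤ K` for all `x`, then `‖â(k)‖ ≤ K · ((1 + |k|²)^m)⁻¹` for every `k`
(Grafakos 2014, §3.3.1 / Prop. 3.2.6 (8): smoothness gives polynomial decay). [cite: Grafakos2014, Prop. 3.2.6 (8)] -/
theorem norm_mFourierCoeff_le_of_iterate_bound {a : UnitAddTorus d → EuclideanSpace ℝ d}
    (ha : IsSmooth a) {m : ℕ} {K : ℝ}
    (hK : ∀ x, ‖((fun b : UnitAddTorus d → EuclideanSpace ℝ d =>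
      fun x => b x - (4 * Real.pi ^ 2)⁻¹ • laplacian b x)^[m] a) x‖ ≤ K) (k : d → ℤ) :
    ‖mFourierCoeff (EuclideanSpace.complexify ∘ a) k‖ ≤ K * ((1 + freqNormSq k) ^ m)⁻¹ := by
  have hpos : 0 < (1 + freqNormSq k) ^ m := pow_pos (by linarith [freqNormSq_nonneg k]) m
  have h := norm_mFourierCoeff_le_of_forall_norm_le (g := EuclideanSpace.complexify ∘
    (fun b : UnitAddTorus d → EuclideanSpace ℝ d =>
      fun x => b x - (4 * Real.pi ^ 2)⁻¹ • laplacian b x)^[m] a) (C := K)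
    (fun x => by rw [Function.comp_apply, EuclideanSpace.norm_complexify]; exact hK x) k
  rw [mFourierCoeff_complexify_iterate_oneSubLaplacian ha m k, norm_smul, Complex.norm_real,
    Real.norm_eq_abs, abs_of_pos hpos] at h
  rw [← div_eq_mul_inv, le_div_iff₀ hpos, mul_comm]
  exact h

omit [DecidableEq d] in
/-- The iterated elliptic operator of a smooth field is bounded on the (compact) torus. [folklore] -/
theorem exists_iterate_bound {a : UnitAddTorus d → EuclideanSpace ℝ d} [DecidableEq d] (ha : IsSmooth a)
    (m : ℕ) :
    ∃ K : ℝ, 0 ≤ K ∧ ∀ x, ‖((fun b : UnitAddTorus d → EuclideanSpace ℝ d =>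
      fun x => b x - (4 * Real.pi ^ 2)⁻¹ • laplacian b x)^[m] a) x‖ ≤ K := by
  obtain ⟨K, hK⟩ := isCompact_univ.exists_bound_of_continuousOn
    (isSmooth_iterate_oneSubLaplacian ha m).continuous.continuousOn
  exact ⟨max K 0, le_max_right _ _, fun x => (hK x (mem_univ x)).trans (le_max_left _ _)⟩

/-- **Absolute summability of the Fourier coefficients of a smooth real vector field**, with the
explicit majorant `K · ((1 + |k|²)^{#d})⁻¹` (Grafakos 2014, §3.3.1). [cite: Grafakos2014, Prop. 3.2.6 (8)] -/
theorem summable_norm_mFourierCoeff_of_isSmooth {a : UnitAddTorus d → EuclideanSpace ℝ d}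
    (ha : IsSmooth a) :
    Summable (fun k : d → ℤ => ‖mFourierCoeff (EuclideanSpace.complexify ∘ a) k‖) := by
  obtain ⟨K, -, hK⟩ := exists_iterate_bound ha (Fintype.card d)
  refine Summable.of_nonneg_of_le (fun k => norm_nonneg _)
    (fun k => norm_mFourierCoeff_le_of_iterate_bound ha hK k)
    (summable_inv_one_add_freqNormSq_pow_card.mul_left K)

end Decay

/-! ## Pointwise Fourier inversion and the uniform truncation error for smooth real fields -/

section Inversion

variable [DecidableEq d]

omit [Fintype d] [DecidableEq d] in
/-- Expansion in the standard basis of `ℂ^ι`: `∑ⱼ wⱼ • eⱼ = w`. [folklore] -/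
theorem _root_.EuclideanSpace.sum_apply_smul_single {ι : Type*} [Fintype ι] [DecidableEq ι]
    (w : EuclideanSpace ℂ ι) : ∑ j, w j • EuclideanSpace.single j (1 : ℂ) = w := by
  conv_rhs => rw [← (EuclideanSpace.basisFun ι ℂ).sum_repr w]
  simp [EuclideanSpace.basisFun_apply]

/-- **Pointwise Fourier inversion for smooth real vector fields**:
`complexify (a x) = ∑ₖ e_k(x) 𝓕(complexify ∘ a)(k)` (absolutely convergent; Mathlib's
`UnitAddTorus.hasSum_mFourier_series_apply_of_summable` coordinatewise;
Robinson–Rodrigo–Sadowski 2016, §1.5 on `𝕋³`). [cite: RobinsonRodrigoSadowski2016, §1.5 (1.10)] -/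
theorem hasSum_mFourier_smul_mFourierCoeff {a : UnitAddTorus d → EuclideanSpace ℝ d}
    (ha : IsSmooth a) (x : UnitAddTorus d) :
    HasSum (fun k : d → ℤ => mFourier k x • mFourierCoeff (EuclideanSpace.complexify ∘ a) k)
      (EuclideanSpace.complexify (a x)) := by
  have hsum := summable_norm_mFourierCoeff_of_isSmooth ha
  -- coordinatewise
  have hj : ∀ j : d, HasSum (fun k : d → ℤ => (mFourier k x *
      mFourierCoeff (EuclideanSpace.complexify ∘ a) k j) • EuclideanSpace.single j (1 : ℂ))
      (((a x j : ℝ) : ℂ) • EuclideanSpace.single j (1 : ℂ)) := by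
    intro j
    have hcont : Continuous fun y => ((a y j : ℝ) : ℂ) :=
      Complex.continuous_ofReal.comp ((EuclideanSpace.proj (𝕜 := ℝ) j).continuous.comp ha.continuous)
    set g : C(UnitAddTorus d, ℂ) := ⟨fun y => ((a y j : ℝ) : ℂ), hcont⟩ with hg
    have hgj : ∀ k, mFourierCoeff g k = mFourierCoeff (EuclideanSpace.complexify ∘ a) k j := fun k =>
      (mFourierCoeff_complexify_apply ha.integrable k j).symm
    have hgs : Summable (mFourierCoeff g) :=
      Summable.of_norm_bounded hsum fun k => by
        rw [hgj]; exact PiLp.norm_apply_le _ j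
    have h := (hasSum_mFourier_series_apply_of_summable hgs x).smul_const
      (EuclideanSpace.single j (1 : ℂ))
    have hfun : (fun k : d → ℤ => (mFourierCoeff g k • mFourier k x) • EuclideanSpace.single j (1 : ℂ)) =
        fun k => (mFourier k x * mFourierCoeff (EuclideanSpace.complexify ∘ a) k j) •
          EuclideanSpace.single j (1 : ℂ) := by
      funext k
      rw [hgj, smul_eq_mul, mul_comm]
    rw [hfun] at h
    exact h
  have hvec := hasSum_sum (s := (Finset.univ : Finset d)) fun j _ => hj j
  have hl : (fun k : d → ℤ => ∑ j ∈ Finset.univ, (mFourier k x *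
      mFourierCoeff (EuclideanSpace.complexify ∘ a) k j) • EuclideanSpace.single j (1 : ℂ)) =
      fun k => mFourier k x • mFourierCoeff (EuclideanSpace.complexify ∘ a) k := by
    funext k
    conv_rhs => rw [← EuclideanSpace.sum_apply_smul_single
      (mFourier k x • mFourierCoeff (EuclideanSpace.complexify ∘ a) k)]
    rfl
  have hr : ∑ j ∈ Finset.univ, ((a x j : ℝ) : ℂ) • EuclideanSpace.single j (1 : ℂ) =
      EuclideanSpace.complexify (a x) := by
    conv_rhs => rw [← EuclideanSpace.sum_apply_smul_single (EuclideanSpace.complexify (a x))]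
    rfl
  rw [hl, hr] at hvec
  exact hvec

/-- Real form of pointwise inversion: `a x = ∑ₖ Re (e_k(x) â(k))`. [folklore] -/
theorem hasSum_realPart_mFourier_smul {a : UnitAddTorus d → EuclideanSpace ℝ d} (ha : IsSmooth a)
    (x : UnitAddTorus d) :
    HasSum (fun k : d → ℤ => EuclideanSpace.realPart
      (mFourier k x • mFourierCoeff (EuclideanSpace.complexify ∘ a) k)) (a x) := by
  have h := (hasSum_mFourier_smul_mFourierCoeff ha x).mapL EuclideanSpace.realPart
  rwa [EuclideanSpace.realPart_complexify] at h

omit [Fintype d] [DecidableEq d] in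
/-- `‖Re (e_k(x) • w)‖ ≤ ‖w‖`. [folklore] -/
theorem norm_realPart_mFourier_smul_le [Fintype d] (k : d → ℤ) (x : UnitAddTorus d)
    (w : EuclideanSpace ℂ d) : ‖EuclideanSpace.realPart (mFourier k x • w)‖ ≤ ‖w‖ := by
  refine (EuclideanSpace.norm_realPart_le _).trans ?_
  rw [norm_smul]
  calc ‖mFourier k x‖ * ‖w‖ ≤ 1 * ‖w‖ :=
        mul_le_mul_of_nonneg_right (((mFourier k).norm_coe_le_norm x).trans_eq mFourier_norm)
          (norm_nonneg _)
    _ = ‖w‖ := one_mul _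

/-- **Uniform error of the Fourier truncation of a smooth real field**:
`‖a x - P_N a x‖ ≤ ∑_{k ∉ ball N} ‖â(k)‖` for every `x` (Robinson–Rodrigo–Sadowski 2016,
Lemma 4.1 / Thm. 4.4 Step 4: `P_N ψ → ψ` uniformly for smooth `ψ`). [cite: RobinsonRodrigoSadowski2016, Thm. 4.4 Step 4] -/
theorem norm_sub_fourierTruncate_apply_le {a : UnitAddTorus d → EuclideanSpace ℝ d} (ha : IsSmooth a)
    (N : ℕ) (x : UnitAddTorus d) :
    ‖a x - fourierTruncate N a x‖ ≤
      ∑' k : {k // k ∉ freqBall (d := d) N}, ‖mFourierCoeff (EuclideanSpace.complexify ∘ a) k‖ := by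
  have h := hasSum_realPart_mFourier_smul ha x
  have hsplit := h.summable.sum_add_tsum_compl (s := freqBall N)
  rw [h.tsum_eq] at hsplit
  have htrunc : fourierTruncate N a x = ∑ k ∈ freqBall N, EuclideanSpace.realPart
      (mFourier k x • mFourierCoeff (EuclideanSpace.complexify ∘ a) k) := by
    rw [fourierTruncate_eq, realTrigPoly_apply_eq_sum]
  have hdiff : a x - fourierTruncate N a x = ∑' k : ↥((freqBall N : Finset (d → ℤ)) : Set (d → ℤ))ᶜ,
      EuclideanSpace.realPart (mFourier k x • mFourierCoeff (EuclideanSpace.complexify ∘ a) k) := by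
    rw [htrunc, ← hsplit, add_sub_cancel_left]
  rw [hdiff]
  have hns : Summable fun k : ↥((freqBall N : Finset (d → ℤ)) : Set (d → ℤ))ᶜ =>
      ‖mFourierCoeff (EuclideanSpace.complexify ∘ a) k‖ :=
    (summable_norm_mFourierCoeff_of_isSmooth ha).subtype _
  have hns' : Summable fun k : ↥((freqBall N : Finset (d → ℤ)) : Set (d → ℤ))ᶜ =>
      ‖EuclideanSpace.realPart (mFourier k x • mFourierCoeff (EuclideanSpace.complexify ∘ a) k)‖ :=
    Summable.of_nonneg_of_le (fun k => norm_nonneg _) (fun k => norm_realPart_mFourier_smul_le _ _ _) hns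
  exact (norm_tsum_le_tsum_norm hns').trans
    (Summable.tsum_le_tsum (fun k => norm_realPart_mFourier_smul_le _ _ _) hns' hns)

/-- The truncation error majorant in terms of the decay constant:
`∑_{k ∉ ball N} ‖â(k)‖ ≤ K · ∑_{k ∉ ball N} ((1 + |k|²)^m)⁻¹` when
`‖((1 - (4π²)⁻¹Δ)^m a)(x)‖ ≤ K` (`m = #d`). [folklore] -/
theorem tsum_compl_norm_mFourierCoeff_le {a : UnitAddTorus d → EuclideanSpace ℝ d} (ha : IsSmooth a)
    {K : ℝ} (hK : ∀ x, ‖((fun b : UnitAddTorus d → EuclideanSpace ℝ d =>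
      fun x => b x - (4 * Real.pi ^ 2)⁻¹ • laplacian b x)^[Fintype.card d] a) x‖ ≤ K) (N : ℕ) :
    ∑' k : {k // k ∉ freqBall (d := d) N}, ‖mFourierCoeff (EuclideanSpace.complexify ∘ a) k‖ ≤
      K * ∑' k : {k // k ∉ freqBall (d := d) N}, ((1 + freqNormSq (k : d → ℤ)) ^ Fintype.card d)⁻¹ := by
  rw [← tsum_mul_left]
  refine Summable.tsum_le_tsum (fun k => norm_mFourierCoeff_le_of_iterate_bound ha hK k)
    ((summable_norm_mFourierCoeff_of_isSmooth ha).subtype _)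
    ((summable_inv_one_add_freqNormSq_pow_card.mul_left K).subtype _)

/-- The lattice tails vanish: `∑_{k ∉ ball N} ((1 + |k|²)^{#d})⁻¹ → 0` as `N → ∞`. [folklore] -/
theorem tendsto_tsum_compl_freqBall_inv_pow :
    Tendsto (fun N : ℕ => ∑' k : {k // k ∉ freqBall (d := d) N},
      ((1 + freqNormSq (k : d → ℤ)) ^ Fintype.card d)⁻¹) atTop (𝓝 0) :=
  (tendsto_tsum_compl_atTop_zero fun k : d → ℤ => ((1 + freqNormSq k) ^ Fintype.card d)⁻¹).comp
    tendsto_freqBall_atTop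

/-- **Sup bound for the truncation**: `‖P_N a x‖ ≤ ‖a x‖ + ∑_{k ∉ ball N} ‖â(k)‖`, in particular
the truncations of a smooth field are bounded uniformly in `N`. [folklore] -/
theorem norm_fourierTruncate_apply_le {a : UnitAddTorus d → EuclideanSpace ℝ d} (ha : IsSmooth a)
    (N : ℕ) (x : UnitAddTorus d) :
    ‖fourierTruncate N a x‖ ≤ ‖a x‖ +
      ∑' k : {k // k ∉ freqBall (d := d) N}, ‖mFourierCoeff (EuclideanSpace.complexify ∘ a) k‖ := by
  have h := norm_sub_fourierTruncate_apply_le ha N x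
  have h2 : ‖fourierTruncate N a x‖ ≤ ‖a x‖ + ‖a x - fourierTruncate N a x‖ := by
    calc ‖fourierTruncate N a x‖ = ‖a x - (a x - fourierTruncate N a x)‖ := by rw [sub_sub_cancel]
      _ ≤ ‖a x‖ + ‖a x - fourierTruncate N a x‖ := norm_sub_le _ _
  linarith

end Inversion

/-! ## Truncation commutes with spatial derivatives -/

section Commute

variable [DecidableEq d]

/-- **`∂ⱼ P_N a = P_N ∂ⱼ a`** for smooth real `a` (both are the real trigonometric polynomial with
coefficients `2πi kⱼ â(k)` on the ball; Robinson–Rodrigo–Sadowski 2016, Lemma 2.9: the truncation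
commutes with derivatives). [cite: RobinsonRodrigoSadowski2016, Lemma 2.9] -/
theorem partialDeriv_fourierTruncate {a : UnitAddTorus d → EuclideanSpace ℝ d} (ha : IsSmooth a)
    (N : ℕ) (j : d) (x : UnitAddTorus d) :
    partialDeriv j (fourierTruncate N a) x = fourierTruncate N (partialDeriv j a) x := by
  rw [fourierTruncate_eq, fourierTruncate_eq, partialDeriv_realTrigPoly]
  refine congrFun (realTrigPoly_congr fun k _ => ?_) x
  have h : EuclideanSpace.complexify ∘ partialDeriv j a = partialDeriv j (EuclideanSpace.complexify ∘ a) := by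
    funext y
    rw [Function.comp_apply, partialDeriv_complexify_comp ha j y]
  rw [h, mFourierCoeff_partialDeriv ha.complexify_comp j k]

/-- **`Δ P_N a = P_N Δ a`** for smooth real `a`. [cite: RobinsonRodrigoSadowski2016, Lemma 2.9] -/
theorem laplacian_fourierTruncate {a : UnitAddTorus d → EuclideanSpace ℝ d} (ha : IsSmooth a)
    (N : ℕ) (x : UnitAddTorus d) :
    laplacian (fourierTruncate N a) x = fourierTruncate N (laplacian a) x := by
  rw [fourierTruncate_eq, fourierTruncate_eq, laplacian_realTrigPoly]
  refine congrFun (realTrigPoly_congr fun k _ => ?_) x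
  rw [mFourierCoeff_complexify_laplacian ha k]

end Commute

/-! ## Smooth space–time fields: time derivatives of coefficients, uniform truncation error -/

section SpaceTime

variable [DecidableEq d]

omit [DecidableEq d] in
/-- Slices of a field smooth on `ℝ × T^d` are differentiable in time at every point. [folklore] -/
theorem differentiableAt_slice_of_isSmoothSpaceTimeOn {F : Type*} [NormedAddCommGroup F]
    [NormedSpace ℝ F] {ψ : ℝ → UnitAddTorus d → F} (hψ : IsSmoothSpaceTimeOn univ ψ) (t : ℝ)
    (x : UnitAddTorus d) : DifferentiableAt ℝ (fun τ : ℝ => ψ τ x) t := by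
  obtain ⟨y, rfl⟩ := proj_surjective x
  have h : (fun τ : ℝ => ψ τ (proj y)) = stLift ψ ∘ fun τ : ℝ => (τ, y) := by
    funext τ; rfl
  rw [h]
  have hψ' : ContDiff ℝ ∞ (stLift ψ) := by
    have := hψ
    rwa [IsSmoothSpaceTimeOn, univ_prod_univ, contDiffOn_univ] at this
  exact ((hψ'.differentiable (by simp)).differentiableAt).comp t
    (differentiableAt_id.prodMk (differentiableAt_const _))

omit [DecidableEq d] in
/-- **Time derivatives of Fourier coefficients**: for a field `ψ` smooth on `ℝ × T^d`,
`d/dt 𝓕(complexify ∘ ψ t)(k) = 𝓕(complexify ∘ ∂ₜψ t)(k)` (differentiation under the integral,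
`IsSmoothSpaceTimeOn.hasDerivWithinAt_integral`). [folklore] -/
theorem hasDerivAt_mFourierCoeff_slice {ψ : ℝ → UnitAddTorus d → EuclideanSpace ℝ d}
    (hψ : IsSmoothSpaceTimeOn univ ψ) (k : d → ℤ) (t : ℝ) :
    HasDerivAt (fun s => mFourierCoeff (EuclideanSpace.complexify ∘ ψ s) k)
      (mFourierCoeff (EuclideanSpace.complexify ∘ timeDeriv ψ t) k) t := by
  -- the integrand as a smooth space–time field
  set Φ : ℝ → UnitAddTorus d → EuclideanSpace ℂ d :=
    fun s y => mFourier (-k) y • EuclideanSpace.complexify (ψ s y) with hΦ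
  have hψ' : ContDiff ℝ ∞ (stLift ψ) := by
    have := hψ
    rwa [IsSmoothSpaceTimeOn, univ_prod_univ, contDiffOn_univ] at this
  have hΦs : IsSmoothSpaceTimeOn univ Φ := by
    rw [IsSmoothSpaceTimeOn, univ_prod_univ, contDiffOn_univ]
    have hχ : ContDiff ℝ ∞ (fun y : EuclideanSpace ℝ d => mFourier (-k) (proj y)) := isSmooth_mFourier (-k)
    have hcx : ContDiff ℝ ∞ (fun p : ℝ × EuclideanSpace ℝ d =>
        EuclideanSpace.complexify (stLift ψ p)) :=
      (EuclideanSpace.complexify (ι := d)).toContinuousLinearMap.contDiff.comp hψ'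
    exact (hχ.comp contDiff_snd).smul hcx
  have hder := hΦs.hasDerivWithinAt_integral convex_univ (mem_univ t)
  -- identify the function and the derivative
  have hfun : (fun s => ∫ y, Φ s y) = fun s => mFourierCoeff (EuclideanSpace.complexify ∘ ψ s) k := by
    funext s
    rw [mFourierCoeff_eq_integral_volume]
    rfl
  have hpt : ∀ y, timeDerivWithin univ Φ t y =
      mFourier (-k) y • EuclideanSpace.complexify (timeDeriv ψ t y) := by
    intro y
    rw [Torus.timeDerivWithin, derivWithin_univ]
    have h1 : HasDerivAt (fun τ : ℝ => ψ τ y) (deriv (fun τ : ℝ => ψ τ y) t) t :=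
      (differentiableAt_slice_of_isSmoothSpaceTimeOn hψ t y).hasDerivAt
    have h2 := ((EuclideanSpace.complexify (ι := d)).toContinuousLinearMap.hasFDerivAt.comp_hasDerivAt
      t h1).const_smul (mFourier (-k) y)
    exact h2.deriv
  have hint : ∫ y, timeDerivWithin univ Φ t y =
      mFourierCoeff (EuclideanSpace.complexify ∘ timeDeriv ψ t) k := by
    rw [mFourierCoeff_eq_integral_volume]
    exact integral_congr_ae (ae_of_all _ fun y => hpt y)
  rw [hfun, hint] at hder
  exact hder.hasDerivAt univ_mem

omit [DecidableEq d] in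
/-- Slices of the space–time iterated elliptic operator are the iterated elliptic operator of the
slices. [folklore] -/
theorem iterate_spaceTime_slice (ψ : ℝ → UnitAddTorus d → EuclideanSpace ℝ d) (m : ℕ) (t : ℝ) :
    ((fun c : ℝ → UnitAddTorus d → EuclideanSpace ℝ d =>
        fun s x => c s x - (4 * Real.pi ^ 2)⁻¹ • laplacian (c s) x)^[m] ψ) t =
      (fun b : UnitAddTorus d → EuclideanSpace ℝ d =>
        fun x => b x - (4 * Real.pi ^ 2)⁻¹ • laplacian b x)^[m] (ψ t) := by
  induction m generalizing ψ with
  | zero => rfl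
  | succ m ih =>
    rw [Function.iterate_succ_apply, Function.iterate_succ_apply]
    exact ih _

/-- The space–time iterated elliptic operator preserves joint smoothness on `ℝ × T^d`. [folklore] -/
theorem isSmoothSpaceTimeOn_iterate {ψ : ℝ → UnitAddTorus d → EuclideanSpace ℝ d}
    (hψ : IsSmoothSpaceTimeOn univ ψ) (m : ℕ) :
    IsSmoothSpaceTimeOn univ ((fun c : ℝ → UnitAddTorus d → EuclideanSpace ℝ d =>
        fun s x => c s x - (4 * Real.pi ^ 2)⁻¹ • laplacian (c s) x)^[m] ψ) := by
  induction m generalizing ψ with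
  | zero => exact hψ
  | succ m ih =>
    rw [Function.iterate_succ_apply]
    refine ih ?_
    exact hψ.sub ((hψ.laplacian uniqueDiffOn_univ).const_smul _)

/-- **Uniform decay constant on compact time intervals**: for `ψ` smooth on `ℝ × T^d` and every
`T`, there is `K ≥ 0` with `‖((1 - (4π²)⁻¹Δ)^{#d} ψ t)(x)‖ ≤ K` for all `t ∈ [0, T]`, `x`. [folklore] -/
theorem exists_iterate_bound_spaceTime {ψ : ℝ → UnitAddTorus d → EuclideanSpace ℝ d}
    (hψ : IsSmoothSpaceTimeOn univ ψ) (T : ℝ) :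
    ∃ K : ℝ, 0 ≤ K ∧ ∀ t ∈ Icc 0 T, ∀ x, ‖((fun b : UnitAddTorus d → EuclideanSpace ℝ d =>
      fun x => b x - (4 * Real.pi ^ 2)⁻¹ • laplacian b x)^[Fintype.card d] (ψ t)) x‖ ≤ K := by
  obtain ⟨C, hC⟩ := (isSmoothSpaceTimeOn_iterate hψ (Fintype.card d)).exists_norm_le_of_isCompact
    isCompact_Icc (subset_univ _)
  refine ⟨max C 0, le_max_right _ _, fun t ht x => ?_⟩
  rw [← iterate_spaceTime_slice]
  exact (hC t ht x).trans (le_max_left _ _)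

/-- **Uniform truncation error for smooth space–time fields** (Robinson–Rodrigo–Sadowski 2016,
Thm. 4.4 Step 4: `P_N ψ(t) → ψ(t)` uniformly on `[0, T] × T^d`): there is `K ≥ 0` with
`‖ψ t x - P_N ψ(t) x‖ ≤ K · ∑_{k ∉ ball N} ((1 + |k|²)^{#d})⁻¹` for all `N`, `t ∈ [0, T]`, `x`,
and the right-hand side tends to `0` (`tendsto_tsum_compl_freqBall_inv_pow`). [cite: RobinsonRodrigoSadowski2016, Thm. 4.4 Step 4] -/
theorem exists_norm_sub_fourierTruncate_le_spaceTime {ψ : ℝ → UnitAddTorus d → EuclideanSpace ℝ d}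
    (hψ : IsSmoothSpaceTimeOn univ ψ) (T : ℝ) :
    ∃ K : ℝ, 0 ≤ K ∧ ∀ (N : ℕ), ∀ t ∈ Icc 0 T, ∀ x,
      ‖ψ t x - fourierTruncate N (ψ t) x‖ ≤
        K * ∑' k : {k // k ∉ freqBall (d := d) N}, ((1 + freqNormSq (k : d → ℤ)) ^ Fintype.card d)⁻¹ := by
  obtain ⟨K, hK0, hK⟩ := exists_iterate_bound_spaceTime hψ T
  refine ⟨K, hK0, fun N t ht x => ?_⟩
  have hs : IsSmooth (ψ t) := hψ.isSmooth_slice (mem_univ t)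
  exact (norm_sub_fourierTruncate_apply_le hs N x).trans (tsum_compl_norm_mFourierCoeff_le hs (hK t ht) N)

end SpaceTime




end Torus

end Literature.Analysis.FunctionSpaces
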